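import Literature.NumberTheory.GaloisRepresentations.LocalUnitsUnramifiedFrame
import HarnessLib

/-!
# Every finite Galois layer `(Gal(L/K), Lˣ)` of a non-archimedean local field is a class module:
# `H²(Gal(L/K), Lˣ)` is cyclic of order `[L : K]` (Serre, *Local Fields* XIII §3 Prop. 6, §4 Thm. 1;
# Neukirch, *Bonn Lectures* II §5 Thm. (5.2), (5.6))

Topic `NumberTheory/GaloisRepresentations` (local class field theory); namespace
`Literature.NumberTheory.GaloisRepresentations.UnitsLayer` (continuing `LocalCyclicLayerClassModule` —
CYCLIC layers are class modules, `|H²| = [L:K]` being the local class field axiom — and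
`LocalUnitsSecondInequality` — `|H²(Gal(L/K), Lˣ)| ∣ [L:K]` for ALL layers).  Proof file: theorems only
(no definition, no named fact, no instance, no notation; D-0026).  Here the restriction "cyclic" is
removed, by Neukirch's / Serre's unramified reference layer:

* §5 **`natCard_H2_units_eq_finrank_of_isGalois : |H²(Gal(L/K), Lˣ)| = [L : K]`** and
  **`isAddCyclic_H2_units_of_isGalois`** for EVERY finite Galois extension `L/K` of a non-archimedean
  local field `K` (Serre XIII §3 Prop. 6: "`H²(L/K)` is cyclic of order `[L:K]`"; Neukirch II (5.2)
  `H²(L|K) = H²(L'|K)`): the engine's `CyclicReference.natCard_H2_eq_card_quotient` / `isAddCyclic_H2`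
  (Neukirch III §6 (6.3) in `Ĥ⁰`-form, door-c4 g11) fed with the frame `M = L₁ · K_m`, `m = [L₁:K] · f_{L₁}`
  of `LocalUnitsUnramifiedFrame` (`Gal(M/K_m) ⊓ Gal(M/L₁) = 1`, translation input `a^{f_{L₁}} ∈ N_{M/L₁}Mˣ`),
  the cyclic layer `K_m/K` (`isAddCyclic_H2_units`, `natCard_H2_units_eq_finrank`, class of order `m`),
  Hilbert 90 on both layers, and the second inequality; then transport to an abstract `L ≅ L₁ ⊆ K̄`.
  `natCard_H2_res_units_of_isGalois`: `|H²(U, Lˣ)| = |U|` for every `U ≤ Gal(L/K)` (the layer `L/L^U`).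
* §6 **`exists_isClassModule_units_of_isGalois : ∃ φ, IsClassModule (Rep.ofAlgebraAutOnUnits K L) φ`** for
  EVERY finite Galois `L/K` (Neukirch II (5.6) "the formation `(G_K, K̄ˣ)` is a class formation", at the
  finite layer `L/K`; Serre XIII §4), by `IsClassModule.of_card`; with Tate's theorem
  `Ĥⁿ(U, ℤ) ≅ Ĥⁿ⁺²(U, Lˣ)`, `H³(U, Lˣ) = 0`, the abstract reciprocity isomorphism
  `Gal(L/K)ᵃᵇ ≃ Kˣ/N_{L/K}Lˣ` and the norm index `|Kˣ/N_{L/K}Lˣ| = |Gal(L/K)ᵃᵇ|` for all layers.  The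
  generator is NOT normalised here: the invariants `inv_{L/K} u_{L/K} = 1/[L:K]` and their compatibility
  with the tree's `Prop121vii.invLevel` are separate steps.

## References
* J.-P. Serre, *Local Fields*, GTM 67 (1979), Ch. XIII §3 Prop. 6 and Cor. 1, §4 Thm. 1, Thm. 2 and Cor.
  [SerreLocalFields1979]
* J. Neukirch, *Class Field Theory — The Bonn Lectures* (2013), Part II §5 Thm. (5.2), Thm. (5.6), §1
  Thm. (1.7), Cor. (1.8); Part I §7 Thm. (7.3); Part III §6 Thm. (6.3). [Neukirch2013]
* J. W. S. Cassels, A. Fröhlich (eds.), *Algebraic Number Theory* (1967), Ch. VI (Serre) §1.1 Thm. 1.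
  [CasselsFrohlichANT1967]
-/

noncomputable section

open CategoryTheory CategoryTheory.Limits groupCohomology

namespace Literature.NumberTheory.GaloisRepresentations

namespace UnitsLayer

open Literature.Algebra.Homology IntermediateField

/-! ## §5. `|H²(Gal(L/K), Lˣ)| = [L : K]` and cyclicity, for every finite Galois `L/K` -/

section Main

open LocalWeilDatum

variable (K : Type) [Field K] [ValuativeRel K] [TopologicalSpace K] [IsNonarchimedeanLocalField K]

/-- **Serre XIII §3 Prop. 6 / Neukirch II (5.2), for a Galois `L₁ ⊆ K̄`: `H²(Gal(L₁/K), L₁ˣ)` has order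
`[L₁ : K]` and is cyclic.**  Proof (Neukirch III §6 Thm. (6.3) in `Ĥ⁰`-form, the engine's
`CyclicReference.natCard_H2_eq_card_quotient` / `isAddCyclic_H2`): in `Gal(M/K)`, `M = L₁ · K_m`,
`m = [L₁:K] · f_{L₁}`, the cyclic quotient `Gal(K_m/K)` carries a class of order `m` (the cyclic layer
`K_m/K`, `isAddCyclic_H2_units` + `natCard_H2_units_eq_finrank`), `Gal(M/K_m) ⊓ Gal(M/L₁) = 1`, Hilbert 90
on both layers, the translation input `a^{f_{L₁}} ∈ N_{M/L₁} Mˣ` (§4), and the second inequality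
`|H²(Gal(L₁/K), L₁ˣ)| ∣ [L₁:K]` (`natCard_H2_units_dvd_finrank`).
[cite: SerreLocalFields1979, Ch. XIII §3 Prop. 6][cite: Neukirch2013, Part II §5 Thm. (5.2)]
[cite: Neukirch2013, Part III §6 Thm. (6.3)] -/
theorem natCard_H2_units_eq_finrank_and_isAddCyclic_intermediateField
    (L₁ : IntermediateField K (AlgebraicClosure K)) [FiniteDimensional K L₁] [IsGalois K L₁] :
    Nat.card (groupCohomology (Rep.ofAlgebraAutOnUnits K L₁) 2) = Module.finrank K L₁ ∧
      IsAddCyclic (groupCohomology (Rep.ofAlgebraAutOnUnits K L₁) 2) := by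
  classical
  obtain ⟨m, hmd⟩ : ∃ m, Module.finrank K L₁ * fDeg K L₁ = m := ⟨_, rfl⟩
  have hn0 : 0 < Module.finrank K L₁ := Module.finrank_pos
  have hm : 0 < m := hmd ▸ Nat.mul_pos hn0 (fDeg_pos K L₁)
  have hfm : fDeg K L₁ ∣ m := hmd ▸ Dvd.intro_left _ rfl
  -- the frame `M = L₁ · K_m ⊇ T' = K_m, L₁' = L₁`
  haveI := finiteDimensional_unrLevel K L₁ hm
  haveI := isGalois_unrLevel_base K L₁ hm
  haveI := finiteDimensional_unramifiedLevel K hm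
  haveI := isGalois_unramifiedLevel K hm
  haveI := isCyclic_gal_unramifiedLevel K hm
  have hT := unramifiedLevel_le_unrLevel K L₁ m
  have hL := le_unrLevel K L₁ m
  haveI : IsGalois K ↥(IntermediateField.restrict hT) :=
    IsGalois.of_algEquiv (IntermediateField.restrict_algEquiv hT)
  haveI : IsGalois K ↥(IntermediateField.restrict hL) :=
    IsGalois.of_algEquiv (IntermediateField.restrict_algEquiv hL)
  haveI : IsCyclic (↥(IntermediateField.restrict hT) ≃ₐ[K] ↥(IntermediateField.restrict hT)) :=
    isCyclic_of_surjective (IntermediateField.restrict_algEquiv hT).autCongr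
      (IntermediateField.restrict_algEquiv hT).autCongr.surjective
  haveI := isCyclic_quotient_fixingSubgroup K (unrLevel K L₁ m) (IntermediateField.restrict hT)
  have hfinT : Module.finrank K ↥(IntermediateField.restrict hT) = m := by
    rw [← (IntermediateField.restrict_algEquiv hT).toLinearEquiv.finrank_eq, finrank_unramifiedLevel K hm]
  have hfinL : Module.finrank K ↥(IntermediateField.restrict hL) = Module.finrank K L₁ :=
    ((IntermediateField.restrict_algEquiv hL).toLinearEquiv.finrank_eq).symm
  -- the class `u` of order `m` on the cyclic quotient `Gal(K_m/K)`
  obtain ⟨iN⟩ := nonempty_quotientToInvariants_fixingSubgroup_iso K (unrLevel K L₁ m)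
    (IntermediateField.restrict hT) 2
  obtain ⟨iT⟩ := nonempty_groupCohomology_units_iso_of_algEquiv
    (IntermediateField.restrict_algEquiv hT).symm 2
  let eN := iN ≪≫ iT
  haveI : IsAddCyclic (groupCohomology ((Rep.ofAlgebraAutOnUnits K (unrLevel K L₁ m)).quotientToInvariants
      (IntermediateField.restrict hT).fixingSubgroup) 2) :=
    isAddCyclic_of_surjective eN.symm.toLinearEquiv eN.symm.toLinearEquiv.surjective
      (hH := isAddCyclic_H2_units K (unramifiedLevel K m))
  have hcardN : Nat.card (groupCohomology ((Rep.ofAlgebraAutOnUnits K (unrLevel K L₁ m)).quotientToInvariants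
      (IntermediateField.restrict hT).fixingSubgroup) 2) =
      Nat.card ((unrLevel K L₁ m ≃ₐ[K] unrLevel K L₁ m) ⧸ (IntermediateField.restrict hT).fixingSubgroup) := by
    rw [Nat.card_congr eN.toLinearEquiv.toEquiv, natCard_H2_units_eq_finrank K (unramifiedLevel K m),
      finrank_unramifiedLevel K hm, natCard_quotient_fixingSubgroup, hfinT]
  obtain ⟨u, hu⟩ := IsAddCyclic.exists_ofOrder_eq_natCard
    (α := groupCohomology ((Rep.ofAlgebraAutOnUnits K (unrLevel K L₁ m)).quotientToInvariants
      (IntermediateField.restrict hT).fixingSubgroup) 2)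
  rw [hcardN] at hu
  -- degrees: `[L₁:K] · f_{L₁} = [K_m:K]`
  have hdq : Nat.card ((unrLevel K L₁ m ≃ₐ[K] unrLevel K L₁ m) ⧸ (IntermediateField.restrict hL).fixingSubgroup) *
      fDeg K L₁ =
      Nat.card ((unrLevel K L₁ m ≃ₐ[K] unrLevel K L₁ m) ⧸ (IntermediateField.restrict hT).fixingSubgroup) := by
    rw [natCard_quotient_fixingSubgroup, natCard_quotient_fixingSubgroup, hfinL, hfinT, hmd]
  -- the second inequality on the quotient layer `L₁/K`
  obtain ⟨iH⟩ := nonempty_quotientToInvariants_fixingSubgroup_iso K (unrLevel K L₁ m)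
    (IntermediateField.restrict hL) 2
  have h2 : Nat.card (groupCohomology ((Rep.ofAlgebraAutOnUnits K (unrLevel K L₁ m)).quotientToInvariants
      (IntermediateField.restrict hL).fixingSubgroup) 2) ∣
      Nat.card ((unrLevel K L₁ m ≃ₐ[K] unrLevel K L₁ m) ⧸ (IntermediateField.restrict hL).fixingSubgroup) := by
    rw [Nat.card_congr iH.toLinearEquiv.toEquiv, natCard_quotient_fixingSubgroup]
    exact natCard_H2_units_dvd_finrank K ↥(IntermediateField.restrict hL)
  -- Neukirch III (6.3) / Tate VII §11.2 "RESULT"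
  have hNH := fixingSubgroup_inf_fixingSubgroup_eq_bot K L₁ m
  have hN1 := InflationRestriction.isZero_H1_res_units K (unrLevel K L₁ m)
    (IntermediateField.restrict hT).fixingSubgroup
  have hH1 := InflationRestriction.isZero_H1_res_units K (unrLevel K L₁ m)
    (IntermediateField.restrict hL).fixingSubgroup
  have hTr : ∀ a : (Rep.ofAlgebraAutOnUnits K (unrLevel K L₁ m)).V,
      (∀ g : unrLevel K L₁ m ≃ₐ[K] unrLevel K L₁ m, (Rep.ofAlgebraAutOnUnits K (unrLevel K L₁ m)).ρ g a = a) →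
      fDeg K L₁ • a ∈ LinearMap.range (Rep.res (IntermediateField.restrict hL).fixingSubgroup.subtype
        (Rep.ofAlgebraAutOnUnits K (unrLevel K L₁ m))).ρ.norm :=
    fun a ha => nsmul_mem_range_norm_res_fixingSubgroup K L₁ hm hmd hfm a ha
  have hcard := CyclicReference.natCard_H2_eq_card_quotient hNH hN1 hH1 u hu (fDeg K L₁) hdq hTr h2
  have hcyc := CyclicReference.isAddCyclic_H2 hNH hN1 hH1 u hu (fDeg K L₁) hdq hTr h2
  -- transport to `L₁`
  obtain ⟨iL⟩ := nonempty_groupCohomology_units_iso_of_algEquiv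
    (IntermediateField.restrict_algEquiv hL).symm 2
  let eH := iH ≪≫ iL
  refine ⟨?_, isAddCyclic_of_surjective eH.toLinearEquiv eH.toLinearEquiv.surjective⟩
  rw [← Nat.card_congr eH.toLinearEquiv.toEquiv, hcard, natCard_quotient_fixingSubgroup, hfinL]

variable (L : Type) [Field L] [Algebra K L] [FiniteDimensional K L] [IsGalois K L]

/-- **`|H²(Gal(L/K), Lˣ)| = [L : K]` for EVERY finite Galois extension `L/K` of a non-archimedean local
field** (Serre XIII §3 Prop. 6 "`H²(L/K)` is cyclic of order `[L:K]`"; the local Brauer group `Br(L/K)`).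
Via the embedded copy `L ≅ L₁ ⊆ K̄` and §1.
[cite: SerreLocalFields1979, Ch. XIII §3 Prop. 6][cite: Neukirch2013, Part II §5 Thm. (5.2)] -/
theorem natCard_H2_units_eq_finrank_of_isGalois :
    Nat.card (groupCohomology (Rep.ofAlgebraAutOnUnits K L) 2) = Module.finrank K L := by
  haveI : IsGalois K (embeddedField K L) := IsGalois.of_algEquiv (embeddedEquiv K L)
  rw [natCard_groupCohomology_units_congr (embeddedEquiv K L) 2,
    (natCard_H2_units_eq_finrank_and_isAddCyclic_intermediateField K (embeddedField K L)).1,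
    finrank_embeddedField]

/-- `|H²(Gal(L/K), Lˣ)| = |Gal(L/K)|` for every finite Galois `L/K` of a non-archimedean local field.
[cite: SerreLocalFields1979, Ch. XIII §3 Prop. 6] -/
theorem natCard_H2_units_eq_card_of_isGalois :
    Nat.card (groupCohomology (Rep.ofAlgebraAutOnUnits K L) 2) = Nat.card (L ≃ₐ[K] L) := by
  rw [natCard_H2_units_eq_finrank_of_isGalois, IsGalois.card_aut_eq_finrank]

/-- **`H²(Gal(L/K), Lˣ)` is cyclic** for every finite Galois `L/K` of a non-archimedean local field.
[cite: SerreLocalFields1979, Ch. XIII §3 Prop. 6][cite: CasselsFrohlichANT1967, Ch. VI §1.1 Thm. 1] -/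
theorem isAddCyclic_H2_units_of_isGalois :
    IsAddCyclic (groupCohomology (Rep.ofAlgebraAutOnUnits K L) 2) := by
  haveI : IsGalois K (embeddedField K L) := IsGalois.of_algEquiv (embeddedEquiv K L)
  exact isAddCyclic_groupCohomology_units_congr (embeddedEquiv K L).symm 2
    (natCard_H2_units_eq_finrank_and_isAddCyclic_intermediateField K (embeddedField K L)).2

/-- **`|H²(U, Lˣ)| = |U|` for EVERY subgroup `U ≤ Gal(L/K)`** and every finite Galois `L/K` of a
non-archimedean local field: the theorem for the layer `L/L^U` over the local field `L^U`
(`FiniteExtension.isNonarchimedeanLocalField`) — hypothesis II of Neukirch's form (7.3) of Tate's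
theorem for `A = Lˣ`. [cite: Neukirch2013, Part I §7 Thm. (7.3)][cite: SerreLocalFields1979, Ch. XIII §3 Cor. 1] -/
theorem natCard_H2_res_units_of_isGalois (U : Subgroup (L ≃ₐ[K] L)) :
    Nat.card (groupCohomology (Rep.res U.subtype (Rep.ofAlgebraAutOnUnits K L)) 2) = Nat.card U := by
  letI := FiniteExtension.valuativeRel K (IntermediateField.fixedField U)
  letI := FiniteExtension.topologicalSpace K (IntermediateField.fixedField U)
  haveI := FiniteExtension.isNonarchimedeanLocalField K (IntermediateField.fixedField U)
  haveI : IsGalois (IntermediateField.fixedField U) L :=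
    IsGalois.tower_top_of_isGalois K (IntermediateField.fixedField U) L
  rw [natCard_groupCohomology_res_units,
    natCard_H2_units_eq_card_of_isGalois (IntermediateField.fixedField U) L,
    ← Nat.card_congr (IntermediateField.subgroupEquivAlgEquiv U).toEquiv]

/-! ## §6. Every finite Galois layer of a local field is a class module (Neukirch II (5.6); Tate's theorem) -/

/-- **Every finite Galois layer `(Gal(L/K), Lˣ)` of a non-archimedean local field is a CLASS MODULE**:
there is a 2-cocycle `φ` — a generator `[φ] = u_{L/K}` of the cyclic group `H²(Gal(L/K), Lˣ)` of order
`[L:K]` — with `IsClassModule (Rep.ofAlgebraAutOnUnits K L) φ`: I. `H¹(U, Lˣ) = 0` (Hilbert 90),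
II. `|H²(U, Lˣ)| = |U|` for every `U` (§5), `[φ]` of order `|Gal(L/K)|`, by Neukirch's form of Tate's
theorem (`IsClassModule.of_card`).  This is Neukirch II (5.6) "the formation `(G_K, K̄ˣ)` is a class
formation" / Serre XIII §4 at the finite layer `L/K`; the generator is NOT normalised here (the invariant
`inv_{L/K} u_{L/K} = 1/[L:K]` is a separate statement).
[cite: Neukirch2013, Part II §5 Thm. (5.6)][cite: SerreLocalFields1979, Ch. XIII §4 Thm. 1]
[cite: Neukirch2013, Part I §7 Thm. (7.3)] -/
theorem exists_isClassModule_units_of_isGalois :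
    ∃ φ : cocycles₂ (Rep.ofAlgebraAutOnUnits K L), IsClassModule (Rep.ofAlgebraAutOnUnits K L) φ := by
  haveI := isAddCyclic_H2_units_of_isGalois K L
  obtain ⟨x, hx⟩ :=
    IsAddCyclic.exists_ofOrder_eq_natCard (α := groupCohomology (Rep.ofAlgebraAutOnUnits K L) 2)
  obtain ⟨φ, rfl⟩ : ∃ φ : cocycles₂ (Rep.ofAlgebraAutOnUnits K L),
      H2π (Rep.ofAlgebraAutOnUnits K L) φ = x := by
    induction x using H2_induction_on with
    | h φ => exact ⟨φ, rfl⟩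
  exact ⟨φ, IsClassModule.of_card (isZero_H1_res_units K L) (natCard_H2_res_units_of_isGalois K L)
    (by rw [hx, natCard_H2_units_eq_card_of_isGalois])⟩

/-- **Tate's theorem for every finite Galois layer of a local field: `Ĥⁿ(U, ℤ) ≅ Ĥⁿ⁺²(U, Lˣ)`** for
every `n ∈ ℤ` and every `U ≤ Gal(L/K)` (the engine's `IsClassModule.tateIso`).
[cite: Neukirch2013, Part I §7 Thm. (7.3)][cite: SerreLocalFields1979, Ch. XIII §4 Thm. 1] -/
theorem nonempty_tateIso_units_of_isGalois (U : Subgroup (L ≃ₐ[K] L)) [Fintype U] (n : ℤ) :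
    Nonempty (tateCohomology (Rep.res U.subtype (Rep.trivial ℤ (L ≃ₐ[K] L) ℤ)) n ≅
      tateCohomology (Rep.res U.subtype (Rep.ofAlgebraAutOnUnits K L)) (n + 2)) := by
  obtain ⟨φ, hA⟩ := exists_isClassModule_units_of_isGalois K L
  exact hA.nonempty_tateIso U n

/-- **`H³(U, Lˣ) = 0`** for every subgroup `U ≤ Gal(L/K)` of a finite Galois layer of a local field
(`≅ H¹(U, ℤ) = 0`). [cite: Neukirch2013, Part II §1 Cor. (1.8)] -/
theorem isZero_H3_res_units_of_isGalois (U : Subgroup (L ≃ₐ[K] L)) :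
    IsZero (groupCohomology (Rep.res U.subtype (Rep.ofAlgebraAutOnUnits K L)) 3) := by
  obtain ⟨φ, hA⟩ := exists_isClassModule_units_of_isGalois K L
  exact hA.isZero_groupCohomology_three_res U

/-- **The abstract reciprocity isomorphism `Gal(L/K)ᵃᵇ ≃ (Lˣ)^G/N_G Lˣ = Kˣ/N_{L/K}Lˣ`** for EVERY finite
Galois layer of a local field (Tate's theorem at `n = -2`, the engine's `IsClassModule.reciprocityAddEquiv`;
NOT asserted here to be the norm residue symbol — the generator is not normalised).
[cite: SerreLocalFields1979, Ch. XIII §4 Thm. 1 and Thm. 2][cite: Neukirch2013, Part II §1 Thm. (1.7)] -/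
theorem nonempty_reciprocityAddEquiv_units_of_isGalois :
    Nonempty (Additive (Abelianization (L ≃ₐ[K] L)) ≃+ NormResidue (Rep.ofAlgebraAutOnUnits K L)) := by
  obtain ⟨φ, hA⟩ := exists_isClassModule_units_of_isGalois K L
  exact ⟨hA.reciprocityAddEquiv⟩

/-- **The norm index for every finite Galois `L/K` of a local field: `|Kˣ/N_{L/K}Lˣ| = |Gal(L/K)ᵃᵇ|`**
(in the engine's additive packaging `NormResidue (Lˣ) = (Lˣ)^G/N_G Lˣ`).
[cite: SerreLocalFields1979, Ch. XIII §4 Cor. to Thm. 2][cite: Neukirch2013, Part II §1 Thm. (1.7)] -/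
theorem natCard_normResidue_units_eq_of_isGalois :
    Nat.card (NormResidue (Rep.ofAlgebraAutOnUnits K L)) = Nat.card (Abelianization (L ≃ₐ[K] L)) := by
  obtain ⟨e⟩ := nonempty_reciprocityAddEquiv_units_of_isGalois K L
  rw [← Nat.card_congr e.toEquiv]
  rfl

end Main

end UnitsLayer

end Literature.NumberTheory.GaloisRepresentations

end
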